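import Mathlib
import Summits.ValiantsHypothesis.ValiantsHypothesis.Theorems.ValuativeGCTValuativeFlipCyclicPencilCertificate
import Summits.ValiantsHypothesis.ValiantsHypothesis.Theorems.ValuativeGCTValuativeFlipStrataRankRSharp
import Summits.ValiantsHypothesis.ValiantsHypothesis.Theorems.ValuativeGCTValuativeFlipStrataRankLSharp

/-!
# The cyclic tridiagonal pencil at full strength: tangent rank `4n² - O(n)` and certificates at every slope `< √2`

Wall-breaker axis P-explicit for crux `ValuativeGCT.ValuativeFlip` (stmt-ValiantsHypothesis-12624), line
`four-row-count`.  The landed assembly `cyc_finrank_tanV_ge` (`((n-4)/2)(6n-6) ≈ 3n²`, hence the pencil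
hypothesis `H` at slope `6/5` with `n₀ = 160`, `cyc_pencilCertificate`) sums the P4-SIMPLE strata bounds
`2n + 2e - 2` and `4n - 2e - 4`.  With the sharp strata bounds `4n - 20` on BOTH sides
(`sr_finrank_span_ge_sharp`, `sl_finrank_span_ge_sharp`) the same filtered-rank summation gives the
numerically observed order `4n²`:

* `cyc_finrank_tanV_ge_sharp` — `((n-6)/2) · (8n - 40) ≤ finrank tanV` (`n ≥ 10`; strata of even string
  length `e ∈ [4, n-4]`), i.e. `≥ 4n² - 48n + 140`, against the generic value `4n² - 2n + 2` of ANY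
  four-variable pencil (only the `2n - 2` Laplace relations) and the numerical value `4n² - 4n + 2` of
  this pencil;
* `cyc_family_finrank_ge` — the same bound for the span of the explicit family `y_t · (∂_{ij} per)(cycP·y)`
  at size `k + 1 ≥ 10` (pointwise, no `n₀`);
* `cyc_count_slope` — for `a² < 2b²`: `2⌊an/b⌋² + ⌊an/b⌋ + 2 ≤ ((n-6)/2)(8n-40)` for `n ≥ 25b² + 10`;
* `cyc_pencilCertificate_of_sq_lt` — **the pencil certificate at EVERY slope `a/b < √2`**: for all
  large `n` the cyclic tridiagonal pencil `cycP` (invertible coordinate minor `cyc_isUnit`) has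
  `2⌊an/b⌋² + ⌊an/b⌋ + 2 ≤ dim span{y_t · (∂_{ij} per_n)(M(y))}` — the hypothesis of
  `headFlipBody_of_pencilCertificate_slope a b`.

`√2` is the natural limit of the four-row count (det side `2m² + 2` four-variable dimensions against the
per side's `4n² - 2n + 5`), so this is the line `four-row-count` at its maximal reach. [this crux; new]
-/

set_option linter.dupNamespace false

namespace Summit.ValiantsHypothesis.ValiantsHypothesis.Theorems.ValuativeFlip

open MvPolynomial Module
open scoped BigOperators Matrix
open Literature.NumberTheory.DiophantineGeometry
open Literature.Computability.AlgebraicComplexity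

noncomputable section

section rank

variable {K : Type*} [Field K] {n : ℕ}

/-- Sharp rank of the bottom of an even piece: `4n - 20 ≤ finrank (cycW e)_e` for even `e ≥ 3` with
`e + 3 ≤ n`. [this crux] -/
theorem finrank_map_cycW_even_sharp [NeZero n] {α γ : ZMod n → K} (hα : Function.Injective α)
    (hγ : Function.Injective γ) (e : ℕ) (he : e % 2 = 0) (he3 : 3 ≤ e) (hen : e + 3 ≤ n) :
    4 * n - 20 ≤ finrank K ((cycW α γ e).map (weightedHomogeneousComponent bw e)) := by
  rw [cycW_even α γ e he, Submodule.map_span, ← Set.range_comp]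
  have hc : (weightedHomogeneousComponent bw e) ∘ genR α γ e = srGen α γ e (n - 1 - e) :=
    funext fun i => bw_whc_genR α γ e i
  rw [hc]
  exact sr_finrank_span_ge_sharp hα hγ (e := e) (k := n - 1 - e) (by omega) he3 (by omega)

/-- Sharp rank of the bottom of an odd piece: `4n - 20 ≤ finrank (cycW (e+1))_{e+1}` for even
`e ≥ 2` with `e + 4 ≤ n`. [this crux] -/
theorem finrank_map_cycW_odd_sharp [NeZero n] {α γ : ZMod n → K} (hα : Function.Injective α)
    (hγ : Function.Injective γ) (e : ℕ) (he : e % 2 = 0) (he2 : 2 ≤ e) (hen : e + 4 ≤ n) :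
    4 * n - 20 ≤
      finrank K ((cycW α γ (e + 1)).map (weightedHomogeneousComponent bw (e + 1))) := by
  rw [cycW_odd α γ e he, Submodule.map_span, ← Set.range_comp]
  have hc : (weightedHomogeneousComponent bw (e + 1)) ∘ genL α γ e = slGen α γ e (n - 1 - e) :=
    funext fun i => bw_whc_genL α γ e i
  rw [hc]
  exact sl_finrank_span_ge_sharp hα hγ (e := e) (k := n - 1 - e) (by omega) he2 (by omega)

/-- **Rank of the tangent span of the cyclic tridiagonal pencil, sharp form** (explicit
configuration, `α, γ` injective, `2 ≠ 0`, `n ≥ 10`): `((n-6)/2)·(8n-40) ≤ finrank tanV`, i.e.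
`4n² - O(n)`, summing the sharp strata bounds over the even string lengths `e ∈ [4, n-4]`.
[this crux; new] -/
theorem cyc_finrank_tanV_ge_sharp [NeZero n] (h2 : (2 : K) ≠ 0) {α γ : ZMod n → K}
    (hα : Function.Injective α) (hγ : Function.Injective γ) (hn : 10 ≤ n) :
    (n - 6) / 2 * (8 * n - 40) ≤ finrank K (tanV (exL γ) (exM α) (exM' α)) := by
  set s := (n - 6) / 2 with hs
  have hs2 : 2 * s ≤ n - 6 := Nat.mul_div_le (n - 6) 2
  haveI : ∀ d, FiniteDimensional K (cycW α γ d) := fun d => cycW_finiteDimensional α γ d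
  haveI := tanV_finiteDimensional (exL γ) (exM α) (exM' α)
  have hsum := fr_sum_finrank_map_le (cycW α γ) (fun d => weightedHomogeneousComponent bw d)
    (fun d d' h => cycW_le_ker α γ h) (2 * s) 4
  have hY : frY (cycW α γ) 4 (2 * s) ≤ tanV (exL γ) (exM α) (exM' α) :=
    frY_le _ (2 * s) 4 fun d h1 h2' => cycW_le_tanV h2 hα hγ d (by omega) (by omega)
  have hmono := Submodule.finrank_mono hY
  have hpairs : ∀ s', 2 * s' ≤ n - 6 → s' * (8 * n - 40) ≤
      ∑ i ∈ Finset.range (2 * s'), finrank K ((cycW α γ (4 + i)).map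
        (weightedHomogeneousComponent bw (4 + i))) := by
    intro s'
    induction s' with
    | zero => intro; simp
    | succ s' ih =>
      intro hs'
      rw [show 2 * (s' + 1) = 2 * s' + 1 + 1 by ring, Finset.sum_range_succ, Finset.sum_range_succ,
        show 4 + (2 * s' + 1) = (4 + 2 * s') + 1 by ring]
      have h0 := ih (by omega)
      have hR := finrank_map_cycW_even_sharp hα hγ (4 + 2 * s') (by omega) (by omega) (by omega)
      have hL := finrank_map_cycW_odd_sharp hα hγ (4 + 2 * s') (by omega) (by omega) (by omega)
      have hmul : (s' + 1) * (8 * n - 40) = s' * (8 * n - 40) + (8 * n - 40) := by ring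
      rw [hmul]
      generalize s' * (8 * n - 40) = A at h0 ⊢
      omega
  exact le_trans (hpairs s hs2) (le_trans hsum hmono)

end rank

section cert

/-- **The count at slope `a/b < √2`**: for `a² < 2b²` and `n ≥ 25b² + 10`,
`2⌊an/b⌋² + ⌊an/b⌋ + 2 ≤ ((n-6)/2)(8n-40)`. [this crux] -/
theorem cyc_count_slope (a b : ℕ) (hb : 0 < b) (hab : a ^ 2 < 2 * b ^ 2) (n : ℕ)
    (hn : 25 * b ^ 2 + 10 ≤ n) :
    2 * (a * n / b) ^ 2 + a * n / b + 2 ≤ (n - 6) / 2 * (8 * n - 40) := by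
  obtain ⟨p, rfl⟩ : ∃ p, n = p + 10 := ⟨n - 10, by omega⟩
  set t := a * (p + 10) / b with ht
  set s := (p + 10 - 6) / 2 with hs
  have hA : t * b ≤ a * (p + 10) := Nat.div_mul_le_self _ _
  have hS : p + 3 ≤ 2 * s := by
    have h1 := Nat.div_add_mod (p + 10 - 6) 2
    have h2 := Nat.mod_lt (p + 10 - 6) (show 0 < 2 by norm_num)
    omega
  have hB : 8 * (p + 10) - 40 = 2 * (4 * p + 20) := by omega
  rw [hB]
  have hp : 25 * b ^ 2 ≤ p := by omega
  have hb1 : 1 ≤ b := hb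
  have hab' : a ^ 2 + 1 ≤ 2 * b ^ 2 := hab
  -- `a < 2b`, hence `t ≤ 2(p+10)`
  have ha2 : a < 2 * b := by nlinarith
  have ht2 : t ≤ 2 * (p + 10) := by
    by_contra hcon
    rw [not_le] at hcon
    have : 2 * (p + 10) * b < t * b := Nat.mul_lt_mul_of_pos_right hcon hb
    nlinarith
  -- the squared certificate inequality
  have hsq : (t * b) ^ 2 ≤ (a * (p + 10)) ^ 2 := Nat.pow_le_pow_left hA 2
  -- lower bound for the right-hand side
  have hR : (p + 3) * (4 * p + 20) ≤ s * (2 * (4 * p + 20)) := by nlinarith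
  -- it suffices to compare after multiplying by `b²`
  suffices hkey : b ^ 2 * (2 * t ^ 2 + t + 2) ≤ b ^ 2 * ((p + 3) * (4 * p + 20)) by
    have hb2 : 0 < b ^ 2 := by positivity
    exact le_trans (Nat.le_of_mul_le_mul_left hkey hb2) hR
  have e1 : b ^ 2 * (2 * t ^ 2 + t + 2) = 2 * (t * b) ^ 2 + b ^ 2 * t + 2 * b ^ 2 := by ring
  rw [e1]
  have h3 : 2 * (t * b) ^ 2 + 2 * (p + 10) ^ 2 ≤ 4 * b ^ 2 * (p + 10) ^ 2 := by nlinarith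
  have h4 : b ^ 2 * t ≤ b ^ 2 * (2 * (p + 10)) := Nat.mul_le_mul_left _ ht2
  nlinarith [Nat.mul_le_mul_right p hp, Nat.mul_le_mul_right (b ^ 2) hp]

variable {n : ℕ}

/-- **Pointwise rank of the explicit pencil family** (`ν r = r`, size `k + 1 ≥ 10`): the span of the
`y_t · (∂_{ij} per)(M(y))` of the cyclic tridiagonal pencil `cycP ν` has dimension
`≥ ((k+1-6)/2)(8(k+1)-40)`.  The family IS the tangent span `tanV` (`cyc_bridge`). [this crux; new] -/
theorem cyc_family_finrank_ge (k : ℕ) (hk : 9 ≤ k) :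
    (k + 1 - 6) / 2 * (8 * (k + 1) - 40) ≤
      Module.finrank ℂ ↥(Submodule.span ℂ (Set.range fun tc : Fin 4 × (Fin (k + 1) × Fin (k + 1)) =>
          (X tc.1 : MvPolynomial (Fin 4) ℂ) *
            aeval (fun ij : Fin (k + 1) × Fin (k + 1) =>
                ∑ t : Fin 4, cycP (fun r : ZMod (k + 1) => ((r.val : ℕ) : ℂ)) ij t •
                  (X t : MvPolynomial (Fin 4) ℂ))
              (pderiv tc.2 (perPoly (Fin (k + 1)) ℂ)))) := by
  let ν : ZMod (k + 1) → ℂ := fun r => ((r.val : ℕ) : ℂ)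
  have hν : Function.Injective ν := by
    intro x y h
    have h' : ((x.val : ℕ) : ℂ) = ((y.val : ℕ) : ℂ) := h
    exact ZMod.val_injective _ (by exact_mod_cast h')
  have hfam : (fun tc : Fin 4 × (Fin (k + 1) × Fin (k + 1)) => (X tc.1 : MvPolynomial (Fin 4) ℂ) *
      aeval (fun ij : Fin (k + 1) × Fin (k + 1) =>
        ∑ t : Fin 4, cycP ν ij t • (X t : MvPolynomial (Fin 4) ℂ))
        (pderiv tc.2 (perPoly (Fin (k + 1)) ℂ))) =
      fun p : Fin 4 × ZMod (k + 1) × ZMod (k + 1) =>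
        X p.1 * cofF (exL ν) (exM ν) (exM' ν) p.2.1 p.2.2 := by
    funext tc
    exact cyc_bridge k ν tc.1 tc.2.1 tc.2.2
  change _ ≤ Module.finrank ℂ ↥(Submodule.span ℂ (Set.range (fun tc : Fin 4 × (Fin (k + 1) × Fin (k + 1)) =>
    (X tc.1 : MvPolynomial (Fin 4) ℂ) *
      aeval (fun ij : Fin (k + 1) × Fin (k + 1) =>
        ∑ t : Fin 4, cycP ν ij t • (X t : MvPolynomial (Fin 4) ℂ))
        (pderiv tc.2 (perPoly (Fin (k + 1)) ℂ)))))
  rw [hfam]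
  change _ ≤ finrank ℂ ↥(tanV (exL ν) (exM ν) (exM' ν))
  exact cyc_finrank_tanV_ge_sharp (K := ℂ) two_ne_zero hν hν (by omega)

/-- **The cyclic tridiagonal pencil certificate at EVERY slope `a/b < √2`**: for `0 < b` and
`a² < 2b²`, for all large `n` the pencil `cycP` has an invertible `4 × 4` coordinate minor and
`2⌊an/b⌋² + ⌊an/b⌋ + 2 ≤ dim span{y_t · (∂_{ij} per_n)(M(y))}` — the hypothesis of
`headFlipBody_of_pencilCertificate_slope a b` (the line `four-row-count` at its limiting slope `√2`).
[this crux; new] -/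
theorem cyc_pencilCertificate_of_sq_lt (a b : ℕ) (hb : 0 < b) (hab : a ^ 2 < 2 * b ^ 2) :
    ∃ n₀ : ℕ, ∀ n ≥ n₀, ∃ (M : Fin n × Fin n → Fin 4 → ℂ) (c : Fin 4 → Fin n × Fin n),
      IsUnit (Matrix.of fun t t' : Fin 4 => M (c t') t) ∧
      2 * (a * n / b) ^ 2 + a * n / b + 2 ≤
        Module.finrank ℂ ↥(Submodule.span ℂ (Set.range fun tc : Fin 4 × (Fin n × Fin n) =>
          (X tc.1 : MvPolynomial (Fin 4) ℂ) *
            aeval (fun ij : Fin n × Fin n => ∑ t : Fin 4, M ij t • (X t : MvPolynomial (Fin 4) ℂ))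
              (pderiv tc.2 (perPoly (Fin n) ℂ)))) := by
  refine ⟨25 * b ^ 2 + 10, fun n hn => ?_⟩
  obtain ⟨k, rfl⟩ : ∃ k, n = k + 1 := ⟨n - 1, by omega⟩
  exact ⟨cycP (fun r : ZMod (k + 1) => ((r.val : ℕ) : ℂ)),
    (![((0 : ZMod (k + 1)), (1 : ZMod (k + 1))), (1, 2), (0, 0), (1, 1)] :
      Fin 4 → ZMod (k + 1) × ZMod (k + 1)), cyc_isUnit k (by omega),
    le_trans (cyc_count_slope a b hb hab (k + 1) hn) (cyc_family_finrank_ge k (by omega))⟩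

end cert

end

end Summit.ValiantsHypothesis.ValiantsHypothesis.Theorems.ValuativeFlip
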